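import Literature.AlgebraicGeometry.Resolution.DivisorialPart
import Literature.AlgebraicGeometry.Resolution.OrderSemicontinuity
import Literature.AlgebraicGeometry.Resolution.ColonIdealSheafFG
import Literature.AlgebraicGeometry.Resolution.MarkedIdealsArithmetic
import Literature.AlgebraicGeometry.Resolution.HypersurfaceTransform
import HarnessLib

/-!
# Crux `PatchingRelPerfect` (stmt-ResolutionOfSingularities-16161), chain W5.2 — TargetsF6 stage 1, T6-E1a «DIVISORIAL PRE-PHASE»:
# the PEEL phase — dividing the flag by its REGULAR bad prime divisors until the scope condition holds

[OURS · L1 W5.2 · TargetsF6 v1 c3ff68005e5acf4d §1, T6-E1a `StageOnePrephase₃` (res-type-049, TAKING 2026-08-27T10:02:21Z)] Fact-free;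
NOT statements of the manuscript under review.

Stage 1 of the non-graded depth-two engine is driven by the coefficient FLAG `𝔟 ≤ R₁` on the regular threefold `E` and reduces
the order of the marked ideal `(𝔟 ⊔ R₁², 2)` by weight-two blowings up along regular centres `C` with `𝔟 ≤ C²`, `R₁ ≤ C`
(`IsFlagSeq`, TargetsF6 §1). The scope condition `FlagScope` («`Sing(𝔟 ⊔ R₁², 2)` has no divisorial part») reads, at a
codimension-one point `ζ` (a discrete valuation ring), «NOT (`ord_ζ 𝔟 ≥ 2` and `ζ ∈ V(R₁)`)» — a BAD prime divisor is a
`cl{ζ}` with `ord_ζ 𝔟 ≥ 2` and `R₁ ⊆ 𝓘(cl{ζ})`. When a bad prime divisor is REGULAR it is a legitimate flag centre: its ideal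
`𝓟_ζ` is an effective Cartier divisor on the regular `E` (Auslander–Buchsbaum; tree `isEffectiveCartier_primeDivisorIdeal_of_isRegular`),
the blowing up along it is the IDENTITY (`IsBlowup.id`), and the flag laws divide: `𝔟 ↦ 𝔟·𝓟_ζ⁻²`, `R₁ ↦ 𝔟·𝓟_ζ⁻² + R₁·𝓟_ζ⁻¹` — a
PEEL. Peeling lowers `Σ_ζ ord_ζ 𝔟` by two and enlarges `R₁`, so the bad set only shrinks; iterating ends in the scope condition.

This file is GENERIC IN THE SEQUENCE PREDICATE `P ρ 𝔟 R₁ 𝔟' R₁'` (only the shape of `IsFlagSeq.cons` is assumed, as a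
hypothesis `hcons`) and extends a given PREFIX `P ρ 𝔟₀ R₀ 𝔟 R₁` — so the by-name closer instantiates `P := IsFlagSeq` once
res-D-pv-059 AS lead-2 lands the TargetsF6 module, with no transitivity lemma needed.

* `two_le_idealOrder_sup_sq_iff` — at any point with regular local ring: `2 ≤ ord_x (𝔟 ⊔ R₁²) ↔ 2 ≤ ord_x 𝔟 ∧ x ∈ V(R₁)`;
* `flagScope_of_forall_coheight_one` — the scope condition from «no bad codimension-one point»;
* `peel_step` — one peel along a regular bad prime divisor, with the order bookkeeping;
* `peel_loop` — **iterated peeling: if every bad prime divisor is regular, a `P`-sequence of peels (all along the identity)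
  reaches a flag with no bad codimension-one point**, `𝔟' ≠ ⊥` effective Cartier, `𝔟' ≤ R₁'`, `V(R₁') ⊆ V(R₁)`.

AI-written; AI review is weaker than expert review.

## References
* V. Cossart, O. Piltant, J. Algebra 320 (2008), proof of Prop. 4.2 (divisorial part), Prop. 4.4. [CossartPiltant2008]
* H. Kawanoue, K. Matsuki, arXiv:1205.4556 / Publ. RIMS (IFP), §2 (transformation rule of the flag). [KawanoueMatsuki2016]
* H. Matsumura, *Commutative Ring Theory* (1986), Thm. 11.1–11.2 (discrete valuation rings), Thm. 20.3. [Matsumura1987]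
-/

-- `Summit.<Summit>.<Sub>.Theorems` with `Sub = Summit` (single-conjunct summit, D-0017)
set_option linter.dupNamespace false

noncomputable section

open CategoryTheory CategoryTheory.Limits AlgebraicGeometry TopologicalSpace IsLocalRing
open Literature.AlgebraicGeometry.Resolution Scheme.IdealSheafData

namespace Summit.ResolutionOfSingularities.ResolutionOfSingularities.Theorems

universe u

namespace DepthFlagPeel

variable {W : Scheme.{u}}

/-! ## §1 Orders of `𝔟 ⊔ R₁²`, and the scope condition at codimension-one points -/

/-- `ord` is antitone in the ideal. [folklore] -/
private theorem idealOrder_anti' {I J : W.IdealSheafData} (h : I ≤ J) (x : W) : idealOrder J x ≤ idealOrder I x := by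
  refine ENat.forall_natCast_le_iff_le.mp fun c hc => ?_
  rw [le_idealOrder_iff] at hc ⊢
  exact (stalkIdeal_mono h x).trans hc

/-- **`2 ≤ ord_x (𝔟 ⊔ R₁²) ↔ 2 ≤ ord_x 𝔟 ∧ x ∈ V(R₁)`** at a point with (regular, or just non-Artinian) local ring — for
`x ∈ V(R₁)` one has `(R₁²)_x ⊆ 𝔪_x²`, and for `x ∉ V(R₁)` the square is the unit ideal, which is not in `𝔪_x²`.
[cite: KawanoueMatsuki2016, §2] -/
theorem two_le_idealOrder_sup_sq_iff (𝔟 R₁ : W.IdealSheafData) (x : W) [IsRegularLocalRing (W.presheaf.stalk x)] :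
    (2 : ℕ∞) ≤ idealOrder (𝔟 ⊔ R₁ ^ 2) x ↔ (2 : ℕ∞) ≤ idealOrder 𝔟 x ∧ x ∈ R₁.support := by
  have h2 : ((2 : ℕ) : ℕ∞) = 2 := rfl
  rw [← h2, le_idealOrder_iff, le_idealOrder_iff, stalkIdeal_sup, sup_le_iff, stalkIdeal_pow,
    mem_support_iff_stalkIdeal_le]
  refine and_congr Iff.rfl ⟨fun h => ?_, fun h => ?_⟩
  · by_contra hx
    have htop : stalkIdeal R₁ x = ⊤ := by
      by_contra hne
      exact hx (le_maximalIdeal hne)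
    rw [htop, Ideal.top_pow, top_le_iff] at h
    exact (maximalIdeal.isMaximal _).ne_top
      (top_le_iff.mp (h.symm.le.trans (Ideal.pow_le_self two_ne_zero)))
  · exact Ideal.pow_right_mono h 2

/-- **The scope condition from «no bad codimension-one point».** On a regular integral locally Noetherian scheme, with
`𝔟 ≠ ⊥`: if no point `ζ` of codimension one has `ord_ζ 𝔟 ≥ 2` and `ζ ∈ V(R₁)`, then every point of order `≥ 2` for
`𝔟 ⊔ R₁²` has codimension `> 1` (the generic point has order `0`). [cite: CossartPiltant2008, proof of Prop. 4.2] -/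
theorem flagScope_of_forall_coheight_one [IsIntegral W] [IsLocallyNoetherian W] (hW : Scheme.IsRegular W)
    {𝔟 R₁ : W.IdealSheafData} (h𝔟 : 𝔟 ≠ ⊥)
    (h : ∀ ζ : W, Order.coheight ζ = 1 → (2 : ℕ∞) ≤ idealOrder 𝔟 ζ → ζ ∉ R₁.support) (x : W)
    (hx : (2 : ℕ∞) ≤ idealOrder (𝔟 ⊔ R₁ ^ 2) x) : 1 < Order.coheight x := by
  haveI := hW x
  obtain ⟨h𝔟x, hxR⟩ := (two_le_idealOrder_sup_sq_iff 𝔟 R₁ x).mp hx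
  by_contra hle
  rw [not_lt] at hle
  by_cases h0 : Order.coheight x = 0
  · -- the generic point: `ord 𝔟 = 0`
    have hgen : x = genericPoint W := eq_genericPoint_of_coheight_eq_zero h0
    have h1 : (1 : ℕ∞) ≤ idealOrder 𝔟 x := le_trans (by decide) h𝔟x
    rw [one_le_idealOrder_iff] at h1
    exact not_mem_support_genericPoint h𝔟 (hgen ▸ h1)
  · have h1 : Order.coheight x = 1 := le_antisymm hle (Order.one_le_iff_pos.mpr (pos_iff_ne_zero.mpr h0))
    exact h x h1 h𝔟x hxR

/-! ## §2 Codimension-one bookkeeping of a peel -/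

/-- Powers of the maximal ideal of a Noetherian local domain which is not a field are injective in the exponent
(`𝔪ⁿ⁺¹ ≠ 𝔪ⁿ`, Nakayama). [cite: Matsumura1987, Thm. 8.10] -/
private theorem pow_maximalIdeal_injective {R : Type*} [CommRing R] [IsLocalRing R] [IsNoetherianRing R] [IsDomain R]
    (hR : ¬ IsField R) {a b : ℕ} (h : maximalIdeal R ^ a = maximalIdeal R ^ b) : a = b := by
  by_contra hne
  wlog hab : a < b generalizing a b
  · exact this h.symm (Ne.symm hne) (lt_of_le_of_ne (not_lt.mp hab) (Ne.symm hne))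
  have h1 : maximalIdeal R ^ (a + 1) = maximalIdeal R ^ a := by
    refine le_antisymm (Ideal.pow_le_pow_right (Nat.le_succ a)) ?_
    calc maximalIdeal R ^ a = maximalIdeal R ^ b := h
      _ ≤ maximalIdeal R ^ (a + 1) := Ideal.pow_le_pow_right hab
  exact maximalIdeal_pow_succ_ne hR a h1

/-- At a codimension-one point of a regular integral scheme, the order is READ OFF the power: `I_ζ = 𝔪_ζⁿ ⇒ ord_ζ I = n`.
[cite: Matsumura1987, Thm. 11.1] -/
theorem idealOrder_eq_of_stalkIdeal_eq_pow [IsIntegral W] (hW : Scheme.IsRegular W) {ζ : W} (hζ : Order.coheight ζ = 1)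
    {I : W.IdealSheafData} (hI : I ≠ ⊥) {n : ℕ} (hn : stalkIdeal I ζ = maximalIdeal (W.presheaf.stalk ζ) ^ n) :
    idealOrder I ζ = n := by
  obtain ⟨a, ha, he⟩ := exists_stalkIdeal_eq_maximalIdeal_pow hW hζ hI
  haveI := hW ζ
  have hab : a = n := pow_maximalIdeal_injective (not_isField_stalk_of_coheight_eq_one (X := W) hζ) (he.symm.trans hn)
  rw [ha, hab]

variable [IsIntegral W] [IsNoetherian W]

/-- **The peel centre.** For a codimension-one point `ζ` of the regular `W` with `ord_ζ 𝔟 ≥ 2` and `ζ ∈ V(R₁)`, the prime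
divisor ideal `𝓟_ζ` satisfies the flag-permissibility `𝔟 ≤ 𝓟_ζ²`, `R₁ ≤ 𝓟_ζ`, and the identity is a blowing up along it.
[cite: CossartPiltant2008, proof of Prop. 4.2] -/
theorem peel_centre (hW : Scheme.IsRegular W) {𝔟 R₁ : W.IdealSheafData} {ζ : W} (hζ : Order.coheight ζ = 1)
    (hord : (2 : ℕ∞) ≤ idealOrder 𝔟 ζ) (hζR : ζ ∈ R₁.support) :
    𝔟 ≤ primeDivisorIdeal ζ ^ 2 ∧ R₁ ≤ primeDivisorIdeal ζ ∧ IsBlowup (𝟙 W) (primeDivisorIdeal ζ) := by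
  refine ⟨le_primeDivisorIdeal_pow_of_isRegular hW hζ ((le_idealOrder_iff 𝔟 ζ 2).mp hord), ?_,
    IsBlowup.id (isEffectiveCartier_primeDivisorIdeal_of_isRegular hW hζ)⟩
  have h := le_primeDivisorIdeal_pow_of_isRegular hW hζ (I := R₁) (n := 1)
    (by rw [pow_one]; exact (mem_support_iff_stalkIdeal_le R₁ ζ).mp hζR)
  rwa [pow_one] at h

/-- **One PEEL and its bookkeeping.** With `C = 𝓟_ζ` as above and `𝔟' := (𝟙)ᶜ(𝔟, 2)`, `R₁' := 𝔟' ⊔ (𝟙)ᶜ(R₁, 1)`: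
`𝔟 = C² · 𝔟'`; `𝔟' ≠ ⊥` is effective Cartier if `𝔟` is; `𝔟 ≤ 𝔟'`, `R₁ ≤ R₁'`, `𝔟' ≤ R₁'`; `ord_ζ 𝔟' + 2 = ord_ζ 𝔟`; orders of
`𝔟'` are at most those of `𝔟` everywhere. [cite: CossartPiltant2008, proof of Prop. 4.2] [cite: KawanoueMatsuki2016, §2] -/
theorem peel_step (hW : Scheme.IsRegular W) {𝔟 R₁ : W.IdealSheafData} (h𝔟c : IsEffectiveCartier 𝔟) (h𝔟 : 𝔟 ≠ ⊥)
    {ζ : W} (hζ : Order.coheight ζ = 1) (hord : (2 : ℕ∞) ≤ idealOrder 𝔟 ζ) (hζR : ζ ∈ R₁.support) :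
    let C := primeDivisorIdeal ζ
    let 𝔟' := controlledTransform (𝟙 W) C 𝔟 2
    let R₁' := controlledTransform (𝟙 W) C 𝔟 2 ⊔ controlledTransform (𝟙 W) C R₁ 1
    𝔟 = C ^ 2 * 𝔟' ∧ IsEffectiveCartier 𝔟' ∧ 𝔟' ≠ ⊥ ∧ 𝔟 ≤ 𝔟' ∧ R₁ ≤ R₁' ∧ 𝔟' ≤ R₁' ∧
      idealOrder 𝔟' ζ + 2 = idealOrder 𝔟 ζ ∧ (∀ x : W, idealOrder 𝔟' x ≤ idealOrder 𝔟 x) := by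
  intro C 𝔟' R₁'
  obtain ⟨hle2, -, hid⟩ := peel_centre hW (R₁ := R₁) hζ hord hζR
  have hCc : IsEffectiveCartier C := isEffectiveCartier_primeDivisorIdeal_of_isRegular hW hζ
  -- `C² · 𝔟' = 𝔟`
  have hfac : C ^ 2 * 𝔟' = 𝔟 := by
    have h := hid.pow_mul_controlledTransform_eq (I := 𝔟) (μ := 2)
      (by rw [Scheme.IdealSheafData.comap_id, Scheme.IdealSheafData.comap_id]; exact hle2)
    rwa [Scheme.IdealSheafData.comap_id, Scheme.IdealSheafData.comap_id] at h
  have h𝔟'c : IsEffectiveCartier 𝔟' := by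
    have h := h𝔟c
    rw [← hfac] at h
    exact h.of_mul_right
  have h𝔟'ne : 𝔟' ≠ ⊥ := by
    intro h0
    apply h𝔟
    rw [← hfac, h0, Scheme.IdealSheafData.mul_bot]
  have h𝔟le : 𝔟 ≤ 𝔟' := by
    conv_lhs => rw [← hfac]
    exact Scheme.IdealSheafData.le_def.mpr fun U => by
      rw [Scheme.IdealSheafData.ideal_mul, Pi.mul_apply]; exact Ideal.mul_le_left
  have hR₁le : R₁ ≤ R₁' := by
    refine le_trans ?_ le_sup_right
    change R₁ ≤ colon (R₁.comap (𝟙 W)) (C.comap (𝟙 W) ^ 1)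
    calc R₁ = R₁.comap (𝟙 W) := (Scheme.IdealSheafData.comap_id R₁).symm
      _ ≤ _ := le_colon_self _ _
  -- orders at `ζ`: `𝔟_ζ = 𝔪² · 𝔟'_ζ`, `𝔟'_ζ = 𝔪^{a'}` ⇒ `ord_ζ 𝔟 = a' + 2`
  obtain ⟨a', ha', he'⟩ := exists_stalkIdeal_eq_maximalIdeal_pow hW hζ h𝔟'ne
  have hstalk : stalkIdeal 𝔟 ζ = maximalIdeal (W.presheaf.stalk ζ) ^ (a' + 2) := by
    rw [← hfac, stalkIdeal_mul, stalkIdeal_pow, he', pow_add, mul_comm]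
    congr 1
    change stalkIdeal (primeDivisorIdeal ζ) ζ ^ 2 = _
    rw [stalkIdeal_primeDivisorIdeal_self]
  have hordζ : idealOrder 𝔟 ζ = (a' + 2 : ℕ) := idealOrder_eq_of_stalkIdeal_eq_pow hW hζ h𝔟 hstalk
  refine ⟨hfac.symm, h𝔟'c, h𝔟'ne, h𝔟le, hR₁le, le_sup_left, ?_, fun x => idealOrder_anti' h𝔟le x⟩
  rw [ha', hordζ]; norm_cast

/-! ## §3 The peel loop -/

/-- **THE PEEL LOOP.** `W` regular integral Noetherian; `P` any sequence predicate closed under flag steps (the shape of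
`IsFlagSeq.cons`); a prefix `P ρ 𝔟₀ R₀ 𝔟 R₁` ending at a flag `𝔟 ≤ R₁` with `𝔟 ≠ ⊥` effective Cartier; a finite set `T`
containing the codimension-one points of `V(𝔟)`; and EVERY BAD prime divisor REGULAR (`cl{ζ}`, `ζ` of codimension one with
`ord_ζ 𝔟 ≥ 2` and `ζ ∈ V(R₁)`, has regular reduced subscheme). Then finitely many peels — each one `P`-step along the identity
— reach a flag `𝔟' ≤ R₁'` on the SAME scheme with NO bad codimension-one point, `𝔟' ≠ ⊥` effective Cartier, `𝔟 ≤ 𝔟'`,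
`R₁ ≤ R₁'`. Induction on `Σ_{ζ ∈ T} ord_ζ 𝔟`. [cite: CossartPiltant2008, proof of Prop. 4.2] [cite: KawanoueMatsuki2016, §2] -/
theorem peel_loop (hW : Scheme.IsRegular W)
    (P : ∀ ⦃E' E : Scheme.{u}⦄, (E' ⟶ E) → E.IdealSheafData → E.IdealSheafData →
      E'.IdealSheafData → E'.IdealSheafData → Prop)
    (hcons : ∀ ⦃E'' E' E : Scheme.{u}⦄ (τ : E'' ⟶ E') (ρ : E' ⟶ E) (𝔟 R₁ : E.IdealSheafData)
      (𝔟' R₁' : E'.IdealSheafData) (C : E'.IdealSheafData),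
      P ρ 𝔟 R₁ 𝔟' R₁' → Scheme.IsRegular C.subscheme → 𝔟' ≤ C ^ 2 → R₁' ≤ C → IsBlowup τ C →
      P (τ ≫ ρ) 𝔟 R₁ (controlledTransform τ C 𝔟' 2) (controlledTransform τ C 𝔟' 2 ⊔ controlledTransform τ C R₁' 1))
    {E : Scheme.{u}} {ρ : W ⟶ E} {𝔟₀ R₀ : E.IdealSheafData} (T : Finset W)
    (n : ℕ) :
    ∀ {𝔟 R₁ : W.IdealSheafData}, P ρ 𝔟₀ R₀ 𝔟 R₁ → IsEffectiveCartier 𝔟 → 𝔟 ≠ ⊥ → 𝔟 ≤ R₁ →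
      (∀ ζ : W, Order.coheight ζ = 1 → ζ ∈ 𝔟.support → ζ ∈ T) →
      (∀ ζ : W, Order.coheight ζ = 1 → (2 : ℕ∞) ≤ idealOrder 𝔟 ζ → ζ ∈ R₁.support →
        Scheme.IsRegular (primeDivisorIdeal ζ).subscheme) →
      (∑ ζ ∈ T, (idealOrder 𝔟 ζ).toNat) ≤ n →
      ∃ 𝔟' R₁' : W.IdealSheafData, P ρ 𝔟₀ R₀ 𝔟' R₁' ∧ IsEffectiveCartier 𝔟' ∧ 𝔟' ≠ ⊥ ∧ 𝔟' ≤ R₁' ∧ 𝔟 ≤ 𝔟' ∧ R₁ ≤ R₁' ∧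
        (∀ ζ : W, Order.coheight ζ = 1 → (2 : ℕ∞) ≤ idealOrder 𝔟' ζ → ζ ∉ R₁'.support) := by
  induction n with
  | zero =>
    intro 𝔟 R₁ hP h𝔟c h𝔟 hle hT _ hsum
    -- all orders at points of `T` vanish, so no codimension-one point of `V(𝔟)` is bad
    refine ⟨𝔟, R₁, hP, h𝔟c, h𝔟, hle, le_rfl, le_rfl, fun ζ hζ h2 _ => ?_⟩
    have hζT : ζ ∈ T := hT ζ hζ ((one_le_idealOrder_iff 𝔟 ζ).mp (le_trans (by decide) h2))
    have h0 : (idealOrder 𝔟 ζ).toNat = 0 := by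
      have := Finset.sum_eq_zero_iff.mp (Nat.le_zero.mp hsum) ζ hζT
      exact this
    have hfin : idealOrder 𝔟 ζ ≠ ⊤ := idealOrder_ne_top h𝔟 ζ
    have : idealOrder 𝔟 ζ = 0 := by
      rcases ENat.ne_top_iff_exists.mp hfin with ⟨m, hm⟩
      rw [← hm] at h0 ⊢
      simp only [ENat.toNat_coe] at h0
      simp [h0]
    rw [this] at h2
    exact absurd h2 (by decide)
  | succ n ih =>
    intro 𝔟 R₁ hP h𝔟c h𝔟 hle hT hreg hsum
    by_cases hbad : ∃ ζ : W, Order.coheight ζ = 1 ∧ (2 : ℕ∞) ≤ idealOrder 𝔟 ζ ∧ ζ ∈ R₁.support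
    swap
    · push Not at hbad
      exact ⟨𝔟, R₁, hP, h𝔟c, h𝔟, hle, le_rfl, le_rfl, fun ζ hζ h2 hR => hbad ζ hζ h2 hR⟩
    obtain ⟨ζ, hζ, hord, hζR⟩ := hbad
    -- peel along `𝓟_ζ`
    obtain ⟨hle2, hRC, hid⟩ := peel_centre hW (R₁ := R₁) hζ hord hζR
    obtain ⟨-, h𝔟'c, h𝔟'ne, h𝔟le, hR₁le, hle', hdrop, hanti⟩ := peel_step hW (R₁ := R₁) h𝔟c h𝔟 hζ hord hζR
    have hP' := hcons (𝟙 W) ρ 𝔟₀ R₀ 𝔟 R₁ (primeDivisorIdeal ζ) hP (hreg ζ hζ hord hζR) hle2 hRC hid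
    rw [Category.id_comp] at hP'
    -- the measure drops
    have hζT : ζ ∈ T := hT ζ hζ ((one_le_idealOrder_iff 𝔟 ζ).mp (le_trans (by decide) hord))
    have hsum' : (∑ x ∈ T, (idealOrder (controlledTransform (𝟙 W) (primeDivisorIdeal ζ) 𝔟 2) x).toNat) ≤ n := by
      have hlt : (∑ x ∈ T, (idealOrder (controlledTransform (𝟙 W) (primeDivisorIdeal ζ) 𝔟 2) x).toNat) <
          ∑ x ∈ T, (idealOrder 𝔟 x).toNat := by
        refine Finset.sum_lt_sum (fun x _ => ENat.toNat_le_toNat (hanti x) (idealOrder_ne_top h𝔟 x)) ⟨ζ, hζT, ?_⟩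
        have hfin' : idealOrder (controlledTransform (𝟙 W) (primeDivisorIdeal ζ) 𝔟 2) ζ ≠ ⊤ := idealOrder_ne_top h𝔟'ne ζ
        obtain ⟨m, hm⟩ := ENat.ne_top_iff_exists.mp hfin'
        rw [← hm] at hdrop ⊢
        have hfin : idealOrder 𝔟 ζ ≠ ⊤ := idealOrder_ne_top h𝔟 ζ
        obtain ⟨m', hm'⟩ := ENat.ne_top_iff_exists.mp hfin
        rw [← hm'] at hdrop ⊢
        simp only [ENat.toNat_coe]
        have : m + 2 = m' := by exact_mod_cast hdrop
        omega
      omega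
    obtain ⟨𝔟'', R₁'', hP'', hc'', hne'', hle'', h𝔟le'', hRle'', hgood⟩ :=
      ih hP' h𝔟'c h𝔟'ne hle'
        (fun x hx hxs => hT x hx (Scheme.IdealSheafData.support_antitone h𝔟le hxs))
        (fun x hx h2 hR => hreg x hx (le_trans h2 (hanti x)) (Scheme.IdealSheafData.support_antitone hR₁le hR))
        hsum'
    exact ⟨𝔟'', R₁'', hP'', hc'', hne'', hle'', h𝔟le.trans h𝔟le'', hR₁le.trans hRle'', hgood⟩

end DepthFlagPeel

end Summit.ResolutionOfSingularities.ResolutionOfSingularities.Theorems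

end
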